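import Literature.NumberTheory.GaloisRepresentations.AdequacyOrthogonalDegreeThree
import Literature.NumberTheory.EllipticCurves.BinaryQuarticResolventEmbedding
import Literature.RepresentationTheory.Semisimple.BurnsideMatrixSpan
import HarnessLib

/-!
# Symmetric-square images: absolute irreducibility and adequacy (characteristic `3`)

The symmetric square `R(γ) = Sym² γ ∈ GL₃` of `γ ∈ GL₂` (the tree's matrix
`TernaryPairs.symSq`, `BinaryQuarticResolventEmbedding.lean`; packaged as the homomorphism
`Matrix.GeneralLinearGroup.symSq` in `CalegariEvenFontaineMazurTwo.lean`, with
`GeneralLinearGroup.coe_symSq : ↑(symSq g) = TernaryPairs.symSq ↑g` by `rfl`) takes values in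
the orthogonal similitude group of `2A₁`: `R(γ) (2A₁) R(γ)ᵀ = (det γ)² (2A₁)`
(`TernaryPairs.symSq_mul_twoA1_mul_transpose`).  This file records the two facts about images
`Sym² ρ(G) ≤ GL₃` that the `3`-adic adequate-image questions (Calegari's hypothesis
"`Sym² ρ̄|Γ_{ℚ(ζ₃)}` absolutely irreducible with adequate image") reduce to, stated for any
`σ : G →* GL₃(k)` with `σ(g) = R(ρ(g))` (so as not to import the Galois-side file):

* `SymSqIrreducible.isAbsIrreducible_of_symSq` (`char k ≠ 2`): if `ρ : G →* GL₂(k)` is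
  absolutely irreducible on every subgroup of index `1` or `2` containing `ker ρ` — "absolutely
  irreducible and not induced from a quadratic subgroup" — then `Sym² ρ` is absolutely
  irreducible.  Proof: over `k̄` a stable line of `Sym²` (or, through the invariant form `2A₁`,
  a stable plane) is a semi-invariant binary quadratic form, which factors as `ℓ₁ ℓ₂`; the
  stabiliser of the line `ℓ₁ = 0` has index `≤ 2` and acts reducibly; descent to `k` by
  Burnside's theorem (`BurnsideMatrixSpan`).  Image form `isAbsIrreducible_of_symSq'` (subgroups of
  `ρ(G)` of relative index `∣ 2`).
* `isExtendedAdequate_range_of_symSq_of_not_isSolvable`,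
  `isExtendedAdequate_or_index_three_of_symSq_of_not_dvd` (`char k = 3`): Theorem 1.7 of
  Guralnick–Herzig–Tiep for symmetric-square images with `9 ∤ |σ(G)|`, CLASSIFICATION-FREE, from
  `AdequacyOrthogonalDegreeThree.lean`: adequate (extended sense), or an abelian normal subgroup
  of index `3`; in particular adequate when the image is not solvable (projective image `A₅`).
* `isExtendedAdequate_range_symSq` : the two combined — hypotheses on `ρ` only.

What is not here: the cells with `9 ∣ |σ(G)|` (`PSL₂(9)`, which is NOT adequate —
`AdequacyDegreeThreeException.lean` —, `PSL₂(3^a)`, `PGL₂(3^a)`, `a ≥ 2`), for which clauses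
(i)–(ii) of adequacy are Guralnick–Herzig–Tiep Props. 6.10–6.12 (the named fact
`ght2017_adequate_or_index_p_or_psl29`).

## References

* [GHT17] R. Guralnick, F. Herzig, P. H. Tiep, *Adequate subgroups and indecomposable modules*,
  JEMS 19 (2017), Theorem 1.7. [cite: GuralnickHerzigTiep2017]
* F. Calegari, *Even Galois representations and the Fontaine–Mazur conjecture II*, JAMS 25
  (2012), Theorem 1.2 (the hypothesis on `Sym² ρ̄`).
-/

open scoped MatrixGroups Matrix

namespace Literature.NumberTheory.GaloisRepresentations

universe u v w

namespace SymSqIrreducible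

open Literature.NumberTheory.EllipticCurves

/-! ## Binary quadratic forms and the symmetric square -/

section Identities

variable {R : Type u} [CommRing R]

/-- `symSq` commutes with ring homomorphisms. [folklore] -/
theorem symSq_map {S : Type v} [CommRing S] (f : R →+* S) (γ : Matrix (Fin 2) (Fin 2) R) :
    (TernaryPairs.symSq γ).map f = TernaryPairs.symSq (γ.map f) := by
  ext i j
  fin_cases i <;> fin_cases j <;> simp [TernaryPairs.symSq, map_ofNat]

/-- The binary quadratic form `a x² + b x y + c y²` with coefficient vector `w = (a, b, c)`. [folklore] -/
def bqf (w : Fin 3 → R) (v : Fin 2 → R) : R := w 0 * v 0 ^ 2 + w 1 * (v 0 * v 1) + w 2 * v 1 ^ 2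

/-- Unfolding `bqf`. [folklore] -/
theorem bqf_def (w : Fin 3 → R) (v : Fin 2 → R) :
    bqf w v = w 0 * v 0 ^ 2 + w 1 * (v 0 * v 1) + w 2 * v 1 ^ 2 := rfl

/-- **Equivariance**: the column action of `R(γ)` on coefficient vectors is the substitution
`v ↦ v γ` in the form: `Q_{R(γ) w}(v) = Q_w(v γ)`. [folklore] -/
theorem bqf_symSq_mulVec (γ : Matrix (Fin 2) (Fin 2) R) (w : Fin 3 → R) (v : Fin 2 → R) :
    bqf (TernaryPairs.symSq γ *ᵥ w) v = bqf w (v ᵥ* γ) := by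
  simp [bqf, TernaryPairs.symSq, Matrix.mulVec, Matrix.vecMul, dotProduct, Fin.sum_univ_three,
    Fin.sum_univ_two]
  ring

/-- `bqf` is linear in the coefficients: scalars. [folklore] -/
theorem bqf_smul (c : R) (w : Fin 3 → R) (v : Fin 2 → R) : bqf (c • w) v = c * bqf w v := by
  simp [bqf]; ring

end Identities

section Factor

variable {K : Type u} [Field K]

/-- The vector `(c₁, -c₀)`, orthogonal to `c`. [folklore] -/
def perp (c : Fin 2 → K) : Fin 2 → K := ![c 1, -c 0]

/-- `perp c ⬝ c = 0`. [folklore] -/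
theorem perp_dotProduct_self (c : Fin 2 → K) : perp c ⬝ᵥ c = 0 := by
  simp [perp, dotProduct, Fin.sum_univ_two]; ring

/-- In the plane, `perp b ⬝ a = 0` with `b ≠ 0` forces `a ∈ K b`. [folklore] -/
theorem exists_eq_smul_of_perp_dotProduct {a b : Fin 2 → K} (hb : b ≠ 0)
    (h : perp b ⬝ᵥ a = 0) : ∃ t : K, a = t • b := by
  have h' : b 1 * a 0 - b 0 * a 1 = 0 := by
    simpa [perp, dotProduct, Fin.sum_univ_two, sub_eq_add_neg] using h
  by_cases hb0 : b 0 = 0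
  · have hb1 : b 1 ≠ 0 := by
      intro hb1; apply hb; ext i; fin_cases i <;> simp [hb0, hb1]
    refine ⟨a 1 / b 1, ?_⟩
    have ha0 : a 0 = 0 := by
      rw [hb0, zero_mul, sub_zero] at h'
      exact (mul_eq_zero.mp h').resolve_left hb1
    ext i; fin_cases i
    · simp [ha0, hb0]
    · simp [div_mul_cancel₀ _ hb1]
  · refine ⟨a 0 / b 0, ?_⟩
    ext i; fin_cases i
    · simp [div_mul_cancel₀ _ hb0]
    · have e : a 1 = a 0 / b 0 * b 1 := by
        rw [div_mul_eq_mul_div, eq_div_iff hb0]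
        linear_combination -h'
      simpa using e

/-- **Binary quadratic forms factor over an algebraically closed field**: for `w ≠ 0` there are
non-zero `c₁, c₂ ∈ K²` with `Q_w(v) = (v ⬝ c₁)(v ⬝ c₂)`. [folklore] -/
theorem exists_bqf_eq_mul [IsAlgClosed K] {w : Fin 3 → K} (hw : w ≠ 0) :
    ∃ c₁ c₂ : Fin 2 → K, c₁ ≠ 0 ∧ c₂ ≠ 0 ∧ ∀ v, bqf w v = (v ⬝ᵥ c₁) * (v ⬝ᵥ c₂) := by
  by_cases h0 : w 0 = 0
  · refine ⟨![0, 1], ![w 1, w 2], ?_, ?_, fun v => ?_⟩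
    · intro h; have := congrFun h 1; simp at this
    · intro h
      apply hw; ext i; fin_cases i
      · exact h0
      · have := congrFun h 0; simpa using this
      · have := congrFun h 1; simpa using this
    · simp [bqf, dotProduct, Fin.sum_univ_two, h0]; ring
  · -- a root of `w₀ X² + w₁ X + w₂`
    obtain ⟨r, hr⟩ := IsAlgClosed.exists_root
      (Polynomial.C (w 0) * Polynomial.X ^ 2 + Polynomial.C (w 1) * Polynomial.X + Polynomial.C (w 2))
      (by rw [Polynomial.degree_quadratic h0]; decide)
    have hr' : w 0 * r ^ 2 + w 1 * r + w 2 = 0 := by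
      simpa [Polynomial.IsRoot] using hr
    refine ⟨![w 0, w 0 * r + w 1], ![1, -r], ?_, ?_, fun v => ?_⟩
    · intro h; have := congrFun h 0; simp [h0] at this
    · intro h; have := congrFun h 0; simp at this
    · simp [bqf, dotProduct, Fin.sum_univ_two]
      linear_combination (v 1) ^ 2 * hr'

end Factor

/-! ## Invariant lines of the symmetric square -/

section Line

variable {K : Type u} [Field K] {G : Type v} [Group G]

/-- The stabiliser in `G` of the line `K c` under `ρ`. [folklore] -/
def lineStab (ρ : G →* GL (Fin 2) K) (c : Fin 2 → K) : Subgroup G where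
  carrier := {g | ∃ t : K, ((ρ g : GL (Fin 2) K) : Matrix (Fin 2) (Fin 2) K) *ᵥ c = t • c}
  one_mem' := ⟨1, by simp⟩
  mul_mem' := by
    rintro g h ⟨s, hs⟩ ⟨t, ht⟩
    refine ⟨t * s, ?_⟩
    rw [map_mul, Units.val_mul, ← Matrix.mulVec_mulVec, ht, Matrix.mulVec_smul, hs, smul_smul]
  inv_mem' := by
    classical
    rintro g ⟨t, ht⟩
    by_cases hc : c = 0
    · exact ⟨0, by simp [hc]⟩
    have ht0 : t ≠ 0 := by
      rintro rfl
      rw [zero_smul] at ht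
      obtain ⟨v, hv, hv0⟩ : ∃ v ≠ (0 : Fin 2 → K),
          ((ρ g : GL (Fin 2) K) : Matrix (Fin 2) (Fin 2) K) *ᵥ v = 0 := ⟨c, hc, ht⟩
      have := Matrix.exists_mulVec_eq_zero_iff.mp ⟨v, hv, hv0⟩
      exact (Matrix.isUnits_det_units (ρ g)).ne_zero this
    refine ⟨t⁻¹, ?_⟩
    have e : ((ρ g⁻¹ : GL (Fin 2) K) : Matrix (Fin 2) (Fin 2) K) *ᵥ
        (((ρ g : GL (Fin 2) K) : Matrix (Fin 2) (Fin 2) K) *ᵥ c) = c := by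
      rw [Matrix.mulVec_mulVec, ← Units.val_mul, ← map_mul, inv_mul_cancel, map_one, Units.val_one,
        Matrix.one_mulVec]
    rw [ht, Matrix.mulVec_smul] at e
    calc ((ρ g⁻¹ : GL (Fin 2) K) : Matrix (Fin 2) (Fin 2) K) *ᵥ c
        = t⁻¹ • (t • (((ρ g⁻¹ : GL (Fin 2) K) : Matrix (Fin 2) (Fin 2) K) *ᵥ c)) := by
          rw [smul_smul, inv_mul_cancel₀ ht0, one_smul]
      _ = t⁻¹ • c := by rw [e]

/-- Membership in `lineStab`. [folklore] -/
theorem mem_lineStab_iff (ρ : G →* GL (Fin 2) K) (c : Fin 2 → K) (g : G) :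
    g ∈ lineStab ρ c ↔ ∃ t : K, ((ρ g : GL (Fin 2) K) : Matrix (Fin 2) (Fin 2) K) *ᵥ c = t • c :=
  Iff.rfl

/-- `ker ρ ≤ lineStab ρ c`. [folklore] -/
theorem ker_le_lineStab (ρ : G →* GL (Fin 2) K) (c : Fin 2 → K) : ρ.ker ≤ lineStab ρ c := by
  intro g hg
  rw [MonoidHom.mem_ker] at hg
  exact ⟨1, by simp [hg]⟩

/-- If every `ρ(g)` maps `c₁` into `K c₁ ∪ K c₂` (`c₁ ≠ 0`), the stabiliser of `K c₁` has index
`1` or `2`. [folklore] -/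
theorem index_lineStab_dvd_two (ρ : G →* GL (Fin 2) K) {c₁ c₂ : Fin 2 → K} (hc₁ : c₁ ≠ 0)
    (h : ∀ g, (∃ t : K, ((ρ g : GL (Fin 2) K) : Matrix (Fin 2) (Fin 2) K) *ᵥ c₁ = t • c₁) ∨
      (∃ t : K, ((ρ g : GL (Fin 2) K) : Matrix (Fin 2) (Fin 2) K) *ᵥ c₁ = t • c₂)) :
    (lineStab ρ c₁).index ∣ 2 := by
  classical
  by_cases htop : lineStab ρ c₁ = ⊤
  · rw [htop, Subgroup.index_top]; exact one_dvd 2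
  obtain ⟨a, ha⟩ : ∃ a, a ∉ lineStab ρ c₁ := by
    by_contra! hall
    exact htop (eq_top_iff.mpr fun g _ => hall g)
  suffices hidx : (lineStab ρ c₁).index = 2 by rw [hidx]
  rw [Subgroup.index_eq_two_iff_exists_notMem_and]
  refine ⟨a, ha, fun b => ?_⟩
  by_cases hb : b ∈ lineStab ρ c₁
  · exact Or.inr hb
  left
  -- `ρ(a) c₁ = s c₂`, `ρ(b⁻¹) c₁ = s' c₂` with `s' ≠ 0`, so `ρ(b a) c₁ ∈ K c₁`
  obtain ⟨s, hs⟩ := (h a).resolve_left ha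
  have hb' : b⁻¹ ∉ lineStab ρ c₁ := fun hb' => hb (by simpa using (lineStab ρ c₁).inv_mem hb')
  obtain ⟨s', hs'⟩ := (h b⁻¹).resolve_left hb'
  have hs'0 : s' ≠ 0 := by
    rintro rfl
    rw [zero_smul] at hs'
    have := Matrix.exists_mulVec_eq_zero_iff.mp ⟨c₁, hc₁, hs'⟩
    exact (Matrix.isUnits_det_units (ρ b⁻¹)).ne_zero this
  have hc₂ : c₂ = s'⁻¹ • (((ρ b⁻¹ : GL (Fin 2) K) : Matrix (Fin 2) (Fin 2) K) *ᵥ c₁) := by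
    rw [hs', smul_smul, inv_mul_cancel₀ hs'0, one_smul]
  refine ⟨s * s'⁻¹, ?_⟩
  rw [map_mul, Units.val_mul, ← Matrix.mulVec_mulVec, hs, Matrix.mulVec_smul, hc₂,
    Matrix.mulVec_smul, Matrix.mulVec_mulVec, ← Units.val_mul, ← map_mul, mul_inv_cancel, map_one,
    Units.val_one, Matrix.one_mulVec, smul_smul]

/-- The line `K c` (`c ≠ 0`) stable under `ρ(H)` contradicts irreducibility of `ρ|H`. [folklore] -/
theorem not_isIrreducible_of_line (ρ : G →* GL (Fin 2) K) (H : Subgroup G) {c : Fin 2 → K}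
    (hc : c ≠ 0) (hH : H ≤ lineStab ρ c) :
    ¬(glRepresentation (ρ.comp H.subtype)).IsIrreducible := by
  intro hirr
  let W : Subrepresentation (glRepresentation (ρ.comp H.subtype)) :=
    ⟨K ∙ c, fun h v hv => by
      obtain ⟨a, rfl⟩ := Submodule.mem_span_singleton.mp hv
      obtain ⟨t, ht⟩ := hH h.2
      rw [glRepresentation_apply_apply, MonoidHom.comp_apply, Subgroup.coe_subtype,
        Matrix.mulVec_smul, ht, smul_smul]
      exact Submodule.mem_span_singleton.mpr ⟨a * t, rfl⟩⟩
  rcases hirr.eq_bot_or_eq_top W with h0 | h1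
  · have : c ∈ W.toSubmodule := Submodule.mem_span_singleton_self c
    rw [h0] at this
    exact hc ((Submodule.mem_bot K).mp this)
  · have hmem : ∀ v : Fin 2 → K, v ∈ (K ∙ c) := fun v => by
      have : v ∈ (⊤ : Subrepresentation (glRepresentation (ρ.comp H.subtype))).toSubmodule :=
        Submodule.mem_top
      rw [← h1] at this
      exact this
    obtain ⟨a, ha⟩ := Submodule.mem_span_singleton.mp (hmem (Pi.single 0 1))
    obtain ⟨b, hb⟩ := Submodule.mem_span_singleton.mp (hmem (Pi.single 1 1))
    have h0' : a * c 1 = 0 := by have := congrFun ha 1; simpa using this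
    have h1' : b * c 0 = 0 := by have := congrFun hb 0; simpa using this
    have ha0 : a ≠ 0 := by
      rintro rfl; have := congrFun ha 0; simp at this
    have hb0 : b ≠ 0 := by
      rintro rfl; have := congrFun hb 1; simp at this
    apply hc; ext i; fin_cases i
    · exact (mul_eq_zero.mp h1').resolve_left hb0
    · exact (mul_eq_zero.mp h0').resolve_left ha0

/-- **No invariant line.**  If `σ(g) = R(ρ(g))` for all `g` and `ρ` restricted to every
subgroup of index `≤ 2` containing `ker ρ` is irreducible over the algebraically closed `K`, then
no line `K w` of `K³` is stable under all `σ(g)`. [folklore] -/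
theorem false_of_line [IsAlgClosed K] (ρ : G →* GL (Fin 2) K) (σ : G →* GL (Fin 3) K)
    (hσ : ∀ g, ((σ g : GL (Fin 3) K) : Matrix (Fin 3) (Fin 3) K) =
      TernaryPairs.symSq ((ρ g : GL (Fin 2) K) : Matrix (Fin 2) (Fin 2) K))
    (hirr : ∀ H : Subgroup G, ρ.ker ≤ H → H.index ∣ 2 →
      (glRepresentation (ρ.comp H.subtype)).IsIrreducible)
    {w : Fin 3 → K} (hw : w ≠ 0)
    (hinv : ∀ g, ∃ χ : K, ((σ g : GL (Fin 3) K) : Matrix (Fin 3) (Fin 3) K) *ᵥ w = χ • w) :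
    False := by
  obtain ⟨c₁, c₂, hc₁, hc₂, hfac⟩ := exists_bqf_eq_mul hw
  -- semi-invariance of `Q_w`
  have hsemi : ∀ g, ∃ χ : K, χ ≠ 0 ∧ ∀ v : Fin 2 → K,
      (v ⬝ᵥ (((ρ g : GL (Fin 2) K) : Matrix (Fin 2) (Fin 2) K) *ᵥ c₁)) *
        (v ⬝ᵥ (((ρ g : GL (Fin 2) K) : Matrix (Fin 2) (Fin 2) K) *ᵥ c₂)) =
      χ * ((v ⬝ᵥ c₁) * (v ⬝ᵥ c₂)) := by
    intro g
    obtain ⟨χ, hχ⟩ := hinv g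
    refine ⟨χ, ?_, fun v => ?_⟩
    · rintro rfl
      rw [zero_smul] at hχ
      have := Matrix.exists_mulVec_eq_zero_iff.mp ⟨w, hw, hχ⟩
      exact (Matrix.isUnits_det_units (σ g)).ne_zero this
    · have e := congrArg (fun x => bqf x v) hχ
      rw [hσ g, bqf_symSq_mulVec, bqf_smul, hfac, hfac] at e
      rwa [Matrix.dotProduct_mulVec, Matrix.dotProduct_mulVec]
  -- dichotomy for `ρ(g) c₁`
  have hdich : ∀ g, (∃ t : K, ((ρ g : GL (Fin 2) K) : Matrix (Fin 2) (Fin 2) K) *ᵥ c₁ = t • c₁) ∨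
      (∃ t : K, ((ρ g : GL (Fin 2) K) : Matrix (Fin 2) (Fin 2) K) *ᵥ c₁ = t • c₂) := by
    intro g
    obtain ⟨χ, hχ0, hχ⟩ := hsemi g
    set b := ((ρ g : GL (Fin 2) K) : Matrix (Fin 2) (Fin 2) K) *ᵥ c₁ with hb
    have hb0 : b ≠ 0 := by
      intro h0
      have := Matrix.exists_mulVec_eq_zero_iff.mp ⟨c₁, hc₁, h0⟩
      exact (Matrix.isUnits_det_units (ρ g)).ne_zero this
    have h0 := hχ (perp b)
    rw [perp_dotProduct_self, zero_mul, eq_comm, mul_eq_zero, mul_eq_zero] at h0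
    rcases h0 with h0 | h0 | h0
    · exact absurd h0 hχ0
    · obtain ⟨t, ht⟩ := exists_eq_smul_of_perp_dotProduct hb0 h0
      have ht0 : t ≠ 0 := by rintro rfl; rw [zero_smul] at ht; exact hc₁ ht
      exact Or.inl ⟨t⁻¹, by rw [ht, smul_smul, inv_mul_cancel₀ ht0, one_smul]⟩
    · obtain ⟨t, ht⟩ := exists_eq_smul_of_perp_dotProduct hb0 h0
      have ht0 : t ≠ 0 := by rintro rfl; rw [zero_smul] at ht; exact hc₂ ht
      exact Or.inr ⟨t⁻¹, by rw [ht, smul_smul, inv_mul_cancel₀ ht0, one_smul]⟩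
  have hidx := index_lineStab_dvd_two ρ hc₁ hdich
  exact not_isIrreducible_of_line ρ (lineStab ρ c₁) hc₁ le_rfl
    (hirr _ (ker_le_lineStab ρ c₁) hidx)

end Line

/-! ## From a stable plane to a stable line, and the main theorem -/

section Plane

variable {K : Type u} [Field K] {G : Type v} [Group G]

/-- `(2A₁) n = (n₂, -2 n₁, n₀)`. [folklore] -/
theorem twoA1_mulVec (n : Fin 3 → K) :
    (TernaryPairs.twoA1 : Matrix (Fin 3) (Fin 3) K) *ᵥ n = ![n 2, -2 * n 1, n 0] := by
  ext i
  fin_cases i <;> simp [TernaryPairs.twoA1, Matrix.mulVec, dotProduct, Fin.sum_univ_three]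

/-- `(2A₁) n = 0 ⇒ n = 0` (`char ≠ 2`). [folklore] -/
theorem eq_zero_of_twoA1_mulVec (h2 : (2 : K) ≠ 0) {n : Fin 3 → K}
    (h : (TernaryPairs.twoA1 : Matrix (Fin 3) (Fin 3) K) *ᵥ n = 0) : n = 0 := by
  rw [twoA1_mulVec] at h
  have h0 := congrFun h 0
  have h1 := congrFun h 1
  have h2' := congrFun h 2
  simp only [Matrix.cons_val_zero, Matrix.cons_val_one, Matrix.cons_val, Pi.zero_apply] at h0 h1 h2'
  ext i
  fin_cases i
  · exact h2'
  · simpa [h2] using h1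
  · exact h0

/-- **A stable subspace yields a stable line.**  For `σ(g) = R(ρ(g))` and a non-zero proper
subspace `W ≤ K³` stable under all `σ(g)`: either `W` is a line, or `W = n^⊥` is a plane, `n` is
a common eigenvector of the `σ(g)ᵀ`, and `(2A₁) n` is a common eigenvector of the `σ(g)`
(`R (2A₁) Rᵀ = (det γ)² (2A₁)`).  Requires `char K ≠ 2`. [folklore] -/
theorem exists_line_of_stable (h2 : (2 : K) ≠ 0) (ρ : G →* GL (Fin 2) K) (σ : G →* GL (Fin 3) K)
    (hσ : ∀ g, ((σ g : GL (Fin 3) K) : Matrix (Fin 3) (Fin 3) K) =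
      TernaryPairs.symSq ((ρ g : GL (Fin 2) K) : Matrix (Fin 2) (Fin 2) K))
    (W : Submodule K (Fin 3 → K))
    (hW : ∀ g, ∀ x ∈ W, ((σ g : GL (Fin 3) K) : Matrix (Fin 3) (Fin 3) K) *ᵥ x ∈ W)
    (h0 : W ≠ ⊥) (h1 : W ≠ ⊤) :
    ∃ w : Fin 3 → K, w ≠ 0 ∧
      ∀ g, ∃ χ : K, ((σ g : GL (Fin 3) K) : Matrix (Fin 3) (Fin 3) K) *ᵥ w = χ • w := by
  obtain ⟨w₁, hw₁W, hw₁⟩ := Submodule.exists_mem_ne_zero_of_ne_bot h0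
  by_cases hline : ∀ x ∈ W, ∃ a : K, x = a • w₁
  · refine ⟨w₁, hw₁, fun g => ?_⟩
    obtain ⟨a, ha⟩ := hline _ (hW g w₁ hw₁W)
    exact ⟨a, ha⟩
  push Not at hline
  obtain ⟨w₂, hw₂W, hw₂⟩ := hline
  have hind : LinearIndependent K ![w₁, w₂] := by
    rw [LinearIndependent.pair_iff' hw₁]
    intro a ha
    exact hw₂ a ha.symm
  set n := w₁ ⨯₃ w₂ with hn
  have hn0 : n ≠ 0 := crossProduct_ne_zero_iff_linearIndependent.mpr hind
  have hn1 : n ⬝ᵥ w₁ = 0 := by rw [hn, dotProduct_comm]; exact dot_self_cross w₁ w₂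
  have hn2 : n ⬝ᵥ w₂ = 0 := by rw [hn, dotProduct_comm]; exact dot_cross_self w₁ w₂
  -- `W ⊆ n^⊥` (otherwise `W = ⊤`)
  have hWn : ∀ x ∈ W, n ⬝ᵥ x = 0 := by
    intro x hx
    by_contra hx0
    apply h1
    rw [eq_top_iff]
    rintro y -
    have hy'n : n ⬝ᵥ (y - ((n ⬝ᵥ y) / (n ⬝ᵥ x)) • x) = 0 := by
      rw [dotProduct_sub, dotProduct_smul, smul_eq_mul, div_mul_cancel₀ _ hx0, sub_self]
    obtain ⟨a, b, hab⟩ := OrthogonalDegreeThree.exists_eq_lin_of_dot_eq_zero hn0 hn1 hn2 hy'n hind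
    have e : y = (y - ((n ⬝ᵥ y) / (n ⬝ᵥ x)) • x) + ((n ⬝ᵥ y) / (n ⬝ᵥ x)) • x := by abel
    rw [e, hab]
    exact W.add_mem (W.add_mem (W.smul_mem a hw₁W) (W.smul_mem b hw₂W)) (W.smul_mem _ hx)
  -- `σ(g)ᵀ n ∈ K n`
  have htn : ∀ g, ∃ a : K,
      a • n = (((σ g : GL (Fin 3) K) : Matrix (Fin 3) (Fin 3) K))ᵀ *ᵥ n := by
    intro g
    have h1' : w₁ ⬝ᵥ ((((σ g : GL (Fin 3) K) : Matrix (Fin 3) (Fin 3) K))ᵀ *ᵥ n) = 0 := by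
      rw [Matrix.mulVec_transpose, dotProduct_comm, ← Matrix.dotProduct_mulVec]
      exact hWn _ (hW g w₁ hw₁W)
    have h2' : w₂ ⬝ᵥ ((((σ g : GL (Fin 3) K) : Matrix (Fin 3) (Fin 3) K))ᵀ *ᵥ n) = 0 := by
      rw [Matrix.mulVec_transpose, dotProduct_comm, ← Matrix.dotProduct_mulVec]
      exact hWn _ (hW g w₂ hw₂W)
    exact OrthogonalDegreeThree.exists_smul_cross_of_dot_eq_zero hind h1' h2'
  -- pass to the column action through `B = 2A₁`
  set B : Matrix (Fin 3) (Fin 3) K := TernaryPairs.twoA1 with hB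
  refine ⟨B *ᵥ n, fun h => hn0 (eq_zero_of_twoA1_mulVec h2 h), fun g => ?_⟩
  obtain ⟨a, ha⟩ := htn g
  set S : Matrix (Fin 3) (Fin 3) K := ((σ g : GL (Fin 3) K) : Matrix (Fin 3) (Fin 3) K) with hS
  set μ : K := ((ρ g : GL (Fin 2) K) : Matrix (Fin 2) (Fin 2) K).det ^ 2 with hμ
  have hμ0 : μ ≠ 0 := pow_ne_zero 2 (Matrix.isUnits_det_units (ρ g)).ne_zero
  have hSBS : S * B * Sᵀ = μ • B := by
    rw [hS, hσ g, hB]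
    exact TernaryPairs.symSq_mul_twoA1_mul_transpose _
  -- `μ B n = S B Sᵀ n = a S B n`
  have key : μ • (B *ᵥ n) = a • (S *ᵥ (B *ᵥ n)) := by
    have e := congrArg (fun M : Matrix (Fin 3) (Fin 3) K => M *ᵥ n) hSBS
    rw [← Matrix.mulVec_mulVec, ← Matrix.mulVec_mulVec, ← ha, Matrix.mulVec_smul,
      Matrix.mulVec_smul, Matrix.smul_mulVec] at e
    exact e.symm
  have ha0 : a ≠ 0 := by
    rintro rfl
    rw [zero_smul, smul_eq_zero] at key
    rcases key with h | h
    · exact hμ0 h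
    · exact hn0 (eq_zero_of_twoA1_mulVec h2 h)
  refine ⟨a⁻¹ * μ, ?_⟩
  rw [← smul_smul, key, smul_smul, inv_mul_cancel₀ ha0, one_smul]

/-- **Irreducibility of the symmetric square over an algebraically closed field** of
characteristic `≠ 2`: if `σ(g) = R(ρ(g))` and `ρ` is irreducible on every subgroup of index `1`
or `2` containing `ker ρ`, then `σ` is irreducible on `K³`. [folklore] -/
theorem isIrreducible_of_isAlgClosed [IsAlgClosed K] (h2 : (2 : K) ≠ 0) (ρ : G →* GL (Fin 2) K)
    (σ : G →* GL (Fin 3) K)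
    (hσ : ∀ g, ((σ g : GL (Fin 3) K) : Matrix (Fin 3) (Fin 3) K) =
      TernaryPairs.symSq ((ρ g : GL (Fin 2) K) : Matrix (Fin 2) (Fin 2) K))
    (hirr : ∀ H : Subgroup G, ρ.ker ≤ H → H.index ∣ 2 →
      (glRepresentation (ρ.comp H.subtype)).IsIrreducible) :
    (glRepresentation σ).IsIrreducible := by
  have hbot : (⊥ : Subrepresentation (glRepresentation σ)).toSubmodule = ⊥ := rfl
  have htop : (⊤ : Subrepresentation (glRepresentation σ)).toSubmodule = ⊤ := rfl
  haveI : Nontrivial (Subrepresentation (glRepresentation σ)) := ⟨⟨⊥, ⊤, fun h' => by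
    have h'' := congrArg Subrepresentation.toSubmodule h'
    rw [hbot, htop] at h''
    exact bot_ne_top h''⟩⟩
  refine ⟨fun W => ?_⟩
  by_contra hW
  push Not at hW
  have h0 : W.toSubmodule ≠ ⊥ := fun h =>
    hW.1 (Subrepresentation.toSubmodule_injective (by rw [h, hbot]))
  have h1 : W.toSubmodule ≠ ⊤ := fun h =>
    hW.2 (Subrepresentation.toSubmodule_injective (by rw [h, htop]))
  obtain ⟨w, hw, hinv⟩ := exists_line_of_stable h2 ρ σ hσ W.toSubmodule
    (fun g x hx => W.apply_mem_toSubmodule g hx) h0 h1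
  exact false_of_line ρ σ hσ hirr hw hinv

end Plane

/-! ## Absolute irreducibility over any field of characteristic `≠ 2` -/

section AbsIrreducible

variable {k : Type u} [Field k] {G : Type v} [Group G]

/-- **Absolute irreducibility of the symmetric square.**  Let `char k ≠ 2`, `ρ : G →* GL₂(k)` and
`σ : G →* GL₃(k)` with `σ(g) = R(ρ(g))` the symmetric-square matrix (`TernaryPairs.symSq`; e.g.
`σ = GeneralLinearGroup.symSq ∘ ρ`).  If `ρ` restricted to every subgroup of index `1` or `2`
containing `ker ρ` is absolutely irreducible ("`ρ` is absolutely irreducible and not induced from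
an index-two subgroup"), then `σ = Sym² ρ` is absolutely irreducible.  (Over `k̄` an invariant
line or plane of `Sym²` is a semi-invariant binary quadratic form `ℓ₁ ℓ₂`; the stabiliser of the
line `ℓ₁ = 0` has index `≤ 2` and acts reducibly.  Descent to `k` by Burnside's theorem.)
[folklore] -/
theorem isAbsIrreducible_of_symSq (h2 : (2 : k) ≠ 0) (ρ : G →* GL (Fin 2) k)
    (σ : G →* GL (Fin 3) k)
    (hσ : ∀ g, ((σ g : GL (Fin 3) k) : Matrix (Fin 3) (Fin 3) k) =
      TernaryPairs.symSq ((ρ g : GL (Fin 2) k) : Matrix (Fin 2) (Fin 2) k))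
    (hirr : ∀ H : Subgroup G, ρ.ker ≤ H → H.index ∣ 2 → IsAbsIrreducible (ρ.comp H.subtype)) :
    IsAbsIrreducible σ := by
  intro k' _ f
  let K := AlgebraicClosure k'
  let ι : k' →+* K := algebraMap k' K
  let F : k →+* K := ι.comp f
  have h2K : (2 : K) ≠ 0 := by rw [← map_ofNat F 2]; exact (map_ne_zero F).mpr h2
  let ρK : G →* GL (Fin 2) K := (Matrix.GeneralLinearGroup.map F).comp ρ
  let σK : G →* GL (Fin 3) K := (Matrix.GeneralLinearGroup.map F).comp σ
  have hσK : ∀ g, ((σK g : GL (Fin 3) K) : Matrix (Fin 3) (Fin 3) K) =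
      TernaryPairs.symSq ((ρK g : GL (Fin 2) K) : Matrix (Fin 2) (Fin 2) K) := by
    intro g
    show (((σ g : GL (Fin 3) k) : Matrix (Fin 3) (Fin 3) k)).map F =
      TernaryPairs.symSq ((((ρ g : GL (Fin 2) k) : Matrix (Fin 2) (Fin 2) k)).map F)
    rw [hσ g, symSq_map]
  have hker : ρK.ker = ρ.ker := by
    ext g
    rw [MonoidHom.mem_ker, MonoidHom.mem_ker, MonoidHom.comp_apply,
      ← (Matrix.GeneralLinearGroup.map F).map_one, (glMap_injective_of_ringHom F).eq_iff]
  have hirrK : ∀ H : Subgroup G, ρK.ker ≤ H → H.index ∣ 2 →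
      (glRepresentation (ρK.comp H.subtype)).IsIrreducible := by
    intro H hH hidx
    exact hirr H (hker ▸ hH) hidx K F
  haveI := isIrreducible_of_isAlgClosed h2K ρK σK hσK hirrK
  -- Burnside over `K`, then descend the spanning to `k'`
  have hspanK := Literature.RepresentationTheory.Semisimple.span_eq_top_of_isIrreducible σK
  have hspan' : Submodule.span k' (Set.range fun g =>
      (((Matrix.GeneralLinearGroup.map f).comp σ g : GL (Fin 3) k') :
        Matrix (Fin 3) (Fin 3) k')) = ⊤ := by
    rw [← Literature.RepresentationTheory.Semisimple.span_range_map_eq_top_iff ι]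
    exact hspanK
  exact Literature.RepresentationTheory.Semisimple.isIrreducible_of_span_eq_top
    (by norm_num) _ hspan'

/-- **Image form** of `isAbsIrreducible_of_symSq`: it suffices that every subgroup `H'` of the
image `ρ(G)` of index `1` or `2` in `ρ(G)` be absolutely irreducible on `k²`. [folklore] -/
theorem isAbsIrreducible_of_symSq' (h2 : (2 : k) ≠ 0) (ρ : G →* GL (Fin 2) k)
    (σ : G →* GL (Fin 3) k)
    (hσ : ∀ g, ((σ g : GL (Fin 3) k) : Matrix (Fin 3) (Fin 3) k) =
      TernaryPairs.symSq ((ρ g : GL (Fin 2) k) : Matrix (Fin 2) (Fin 2) k))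
    (hirr : ∀ H' : Subgroup (GL (Fin 2) k), H' ≤ ρ.range → H'.relIndex ρ.range ∣ 2 →
      IsAbsIrreducible H'.subtype) :
    IsAbsIrreducible σ := by
  refine isAbsIrreducible_of_symSq h2 ρ σ hσ fun H hker hidx => ?_
  have hidx' : (H.map ρ).relIndex ρ.range ∣ 2 := by
    rwa [← Subgroup.index_comap, Subgroup.comap_map_eq, sup_eq_left.mpr hker]
  have hH' := hirr (H.map ρ) (Subgroup.map_le_range ρ H) hidx'
  -- the two homomorphisms have the same matrices
  have hset : (Set.range fun h : H.map ρ =>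
      (((H.map ρ).subtype h : GL (Fin 2) k) : Matrix (Fin 2) (Fin 2) k)) =
      Set.range fun h : H => ((ρ.comp H.subtype h : GL (Fin 2) k) : Matrix (Fin 2) (Fin 2) k) := by
    ext M
    constructor
    · rintro ⟨⟨_, g, hg, rfl⟩, rfl⟩
      exact ⟨⟨g, hg⟩, rfl⟩
    · rintro ⟨g, rfl⟩
      exact ⟨⟨ρ g, g, g.2, rfl⟩, rfl⟩
  have h1 := (Literature.RepresentationTheory.Semisimple.span_eq_top_iff_forall_isIrreducible
    two_pos (H.map ρ).subtype).2 hH'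
  rw [hset] at h1
  exact (Literature.RepresentationTheory.Semisimple.span_eq_top_iff_forall_isIrreducible
    two_pos (ρ.comp H.subtype)).1 h1

end AbsIrreducible

end SymSqIrreducible

/-! ## The symmetric-square images (`Sym² GL₂ ≤ GO₃(2A₁)`) -/

section SymSq

open Literature.NumberTheory.EllipticCurves

/-- `2A₁` is symmetric. [folklore] -/
theorem TernaryPairs_twoA1_transpose {R : Type u} [CommRing R] :
    (TernaryPairs.twoA1 : Matrix (Fin 3) (Fin 3) R)ᵀ = TernaryPairs.twoA1 := by
  ext i j; fin_cases i <;> fin_cases j <;> rfl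

/-- `det (2A₁) = 2`. [folklore] -/
theorem TernaryPairs_det_twoA1 {R : Type u} [CommRing R] :
    (TernaryPairs.twoA1 : Matrix (Fin 3) (Fin 3) R).det = 2 := by
  simp [TernaryPairs.twoA1, Matrix.det_fin_three]

/-- **The icosahedral (and every non-solvable, `9 ∤` order) cell of the symmetric square is
adequate, classification-free.**  Let `char k = 3` and `σ : G →* GL₃(k)` be absolutely irreducible
with every `σ(g)` a symmetric-square matrix `R(γ)` (`TernaryPairs.symSq`; e.g.
`σ = GeneralLinearGroup.symSq ∘ ρ` for `ρ : G →* GL₂(k)`), with finite image of order prime to `9`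
and not solvable (e.g. projective image `A₅`).  Then `σ(G)` is adequate in the extended sense.
(`R(γ) (2A₁) R(γ)ᵀ = (det γ)² (2A₁)`, `TernaryPairs.symSq_mul_twoA1_mul_transpose`, and
`isExtendedAdequate_or_index_three_of_similitude_of_not_dvd'` for the inclusion of the image.)
[cite: GuralnickHerzigTiep2017, Theorem 1.7] -/
theorem isExtendedAdequate_range_of_symSq_of_not_isSolvable
    {k : Type u} [Field k] [CharP k 3] {G : Type v} [Group G]
    (σ : G →* GL (Fin 3) k) [Finite σ.range] (hirr : IsAbsIrreducible σ)
    (hσ : ∀ g, ∃ γ : Matrix (Fin 2) (Fin 2) k,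
      ((σ g : GL (Fin 3) k) : Matrix (Fin 3) (Fin 3) k) = TernaryPairs.symSq γ)
    (h9 : ¬9 ∣ Nat.card σ.range) (hns : ¬IsSolvable σ.range) :
    Subgroup.IsExtendedAdequate σ.range := by
  have h2 : (2 : k) ≠ 0 := by
    intro h
    have h3 : (3 : k) = 0 := by exact_mod_cast CharP.cast_eq_zero k 3
    have : (1 : k) = 0 := by
      have e : (1 : k) = 3 - 2 := by norm_num
      rw [e, h3, h, sub_zero]
    exact one_ne_zero this
  have hB : IsUnit (TernaryPairs.twoA1 : Matrix (Fin 3) (Fin 3) k).det := by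
    rw [TernaryPairs_det_twoA1, isUnit_iff_ne_zero]
    exact h2
  -- the faithful row-convention theorem for the inclusion of the image
  have hHO : ∀ h : σ.range, ∃ μ : k,
      ((σ.range.subtype h : GL (Fin 3) k) : Matrix (Fin 3) (Fin 3) k) * TernaryPairs.twoA1 *
        ((σ.range.subtype h : GL (Fin 3) k) : Matrix (Fin 3) (Fin 3) k)ᵀ =
      μ • (TernaryPairs.twoA1 : Matrix (Fin 3) (Fin 3) k) := by
    rintro ⟨_, g, rfl⟩
    obtain ⟨γ, hγ⟩ := hσ g
    refine ⟨γ.det ^ 2, ?_⟩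
    show ((σ g : GL (Fin 3) k) : Matrix (Fin 3) (Fin 3) k) * TernaryPairs.twoA1 *
        ((σ g : GL (Fin 3) k) : Matrix (Fin 3) (Fin 3) k)ᵀ = _
    rw [hγ]
    exact TernaryPairs.symSq_mul_twoA1_mul_transpose γ
  rcases isExtendedAdequate_or_index_three_of_similitude_of_not_dvd' σ.range.subtype
      σ.range.subtype_injective hirr.range_subtype TernaryPairs_twoA1_transpose hB hHO h9 with
    h | ⟨A, hAn, hAc, hAi⟩
  · rwa [Subgroup.range_subtype] at h
  · haveI := hAn
    exact absurd (isSolvable_of_comm_normal_index A hAc hAi) hns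

/-- **Theorem 1.7 (a) ∨ (b) for symmetric-square images with `9 ∤ |G|`**, classification-free:
`σ : G →* GL₃(k)` faithful, absolutely irreducible, every `σ(g)` a symmetric-square matrix,
`9 ∤ |G|` `⇒` `σ(G)` adequate or `G` has an abelian normal subgroup of index `3`.
[cite: GuralnickHerzigTiep2017, Theorem 1.7] -/
theorem isExtendedAdequate_or_index_three_of_symSq_of_not_dvd
    {k : Type u} [Field k] [CharP k 3] {G : Type v} [Group G] [Finite G]
    (σ : G →* GL (Fin 3) k) (hinj : Function.Injective σ) (hirr : IsAbsIrreducible σ)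
    (hσ : ∀ g, ∃ γ : Matrix (Fin 2) (Fin 2) k,
      ((σ g : GL (Fin 3) k) : Matrix (Fin 3) (Fin 3) k) = TernaryPairs.symSq γ)
    (h9 : ¬9 ∣ Nat.card G) :
    Subgroup.IsExtendedAdequate σ.range ∨
      ∃ A : Subgroup G, A.Normal ∧ (∀ x ∈ A, ∀ y ∈ A, x * y = y * x) ∧ A.index = 3 := by
  have h2 : (2 : k) ≠ 0 := by
    intro h
    have h3 : (3 : k) = 0 := by exact_mod_cast CharP.cast_eq_zero k 3
    have : (1 : k) = 0 := by
      have e : (1 : k) = 3 - 2 := by norm_num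
      rw [e, h3, h, sub_zero]
    exact one_ne_zero this
  have hB : IsUnit (TernaryPairs.twoA1 : Matrix (Fin 3) (Fin 3) k).det := by
    rw [TernaryPairs_det_twoA1, isUnit_iff_ne_zero]
    exact h2
  refine isExtendedAdequate_or_index_three_of_similitude_of_not_dvd' σ hinj hirr
    TernaryPairs_twoA1_transpose hB ?_ h9
  intro g
  obtain ⟨γ, hγ⟩ := hσ g
  exact ⟨γ.det ^ 2, by rw [hγ]; exact TernaryPairs.symSq_mul_twoA1_mul_transpose γ⟩

end SymSq

/-! ## The two combined -/

section Combined

open Literature.NumberTheory.EllipticCurves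

/-- **Adequacy of non-solvable symmetric-square images from hypotheses on `ρ` alone**
(`char k = 3`): `σ(g) = R(ρ(g))`, `ρ` absolutely irreducible on every subgroup of index `≤ 2`
containing `ker ρ`, `σ(G)` finite of order prime to `9` and not solvable `⇒` `σ(G)` is adequate in
the extended sense.  (E.g. `ρ̄|Γ_{ℚ(ζ₃)}` with projective image `A₅`.)
[cite: GuralnickHerzigTiep2017, Theorem 1.7] -/
theorem isExtendedAdequate_range_symSq {k : Type u} [Field k] [CharP k 3] {G : Type v} [Group G]
    (ρ : G →* GL (Fin 2) k) (σ : G →* GL (Fin 3) k) [Finite σ.range]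
    (hσ : ∀ g, ((σ g : GL (Fin 3) k) : Matrix (Fin 3) (Fin 3) k) =
      TernaryPairs.symSq ((ρ g : GL (Fin 2) k) : Matrix (Fin 2) (Fin 2) k))
    (hirr : ∀ H : Subgroup G, ρ.ker ≤ H → H.index ∣ 2 → IsAbsIrreducible (ρ.comp H.subtype))
    (h9 : ¬9 ∣ Nat.card σ.range) (hns : ¬IsSolvable σ.range) :
    Subgroup.IsExtendedAdequate σ.range := by
  have h2 : (2 : k) ≠ 0 := by
    intro h
    have h3 : (3 : k) = 0 := by exact_mod_cast CharP.cast_eq_zero k 3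
    have : (1 : k) = 0 := by
      have e : (1 : k) = 3 - 2 := by norm_num
      rw [e, h3, h, sub_zero]
    exact one_ne_zero this
  exact isExtendedAdequate_range_of_symSq_of_not_isSolvable σ
    (SymSqIrreducible.isAbsIrreducible_of_symSq h2 ρ σ hσ hirr) (fun g => ⟨_, hσ g⟩) h9 hns

end Combined

end Literature.NumberTheory.GaloisRepresentations
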